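import Mathlib
import Summits.AnomalousDissipation.AnomalousDissipation.Theorems.SoloBlindLCPUnique

/-!
# Monotone linear complementarity problems: cross-complementarity and uniqueness modulo the kernel

Discrete kernel of the finite-`n` selection step of the steady zeroth-law programme (solo-blind paper
§24.17(7)(e)).  At finite `n` the reduced steady pattern problem degenerates, as the cross-leaf
dispersion `ε → 0`, to the LCP `q ≥ 0`, `Q q - b ≥ 0`, `q ⬝ (Q q - b) = 0` with `b = σ - K₀` and
`Q = T_w = ∂³ S_w` the resolvent-smoothed third derivative.  In the Thomas–Fermi class the symmetric
part of `Q` is only positive SEMI-definite (Fourier symbol `w³k⁶/(1+w⁶k⁶)`, vanishing at `k = 0`):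
`Q` is monotone, its quadratic form vanishes exactly on constants, and `Q` is conservative (columns
sum to zero).  For such LCPs:

* any two solutions have vanishing difference form and are CROSS-complementary (general monotone LCP
  theory);
* they differ by a constant;
* if the supercriticality has nonzero total (`∑ b ≠ 0`, e.g. `b = 1 - s²` on a wide window) the
  solution is unique.

Only finite-dimensional linear algebra is involved; `IsLCPSolution` is the structure of
`SoloBlindLCPUnique`.
-/

namespace Summit.AnomalousDissipation.AnomalousDissipation.Theorems

open Matrix

variable {ι : Type*} [Fintype ι]

/-- For ANY matrix `Q`, the difference of two LCP solutions has nonpositive quadratic form: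
`(q₁ - q₂) ⬝ Q (q₁ - q₂) = -(q₁ ⬝ (Q q₂ - b)) - (q₂ ⬝ (Q q₁ - b)) ≤ 0`. -/
theorem lcp_diff_form_eq (Q : Matrix ι ι ℝ) (b q₁ q₂ : ι → ℝ)
    (h₁ : IsLCPSolution Q b q₁) (h₂ : IsLCPSolution Q b q₂) :
    (q₁ - q₂) ⬝ᵥ (Q *ᵥ (q₁ - q₂))
      = -(q₁ ⬝ᵥ (Q *ᵥ q₂ - b)) - (q₂ ⬝ᵥ (Q *ᵥ q₁ - b)) := by
  have hd₁ : q₁ ⬝ᵥ (Q *ᵥ q₁) = q₁ ⬝ᵥ b := by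
    have := h₁.compl; rw [dotProduct_sub] at this; linarith
  have hd₂ : q₂ ⬝ᵥ (Q *ᵥ q₂) = q₂ ⬝ᵥ b := by
    have := h₂.compl; rw [dotProduct_sub] at this; linarith
  rw [Matrix.mulVec_sub, sub_dotProduct, dotProduct_sub, dotProduct_sub, dotProduct_sub, dotProduct_sub,
    hd₁, hd₂]
  ring

/-- The difference form of two LCP solutions is nonpositive (any `Q`). -/
theorem lcp_diff_form_nonpos (Q : Matrix ι ι ℝ) (b q₁ q₂ : ι → ℝ)
    (h₁ : IsLCPSolution Q b q₁) (h₂ : IsLCPSolution Q b q₂) :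
    (q₁ - q₂) ⬝ᵥ (Q *ᵥ (q₁ - q₂)) ≤ 0 := by
  rw [lcp_diff_form_eq Q b q₁ q₂ h₁ h₂]
  have hc₁ : q₁ ⬝ᵥ b ≤ q₁ ⬝ᵥ (Q *ᵥ q₂) := dotProduct_le_of_nonneg_of_le q₁ _ b h₁.nonneg h₂.feasible
  have hc₂ : q₂ ⬝ᵥ b ≤ q₂ ⬝ᵥ (Q *ᵥ q₁) := dotProduct_le_of_nonneg_of_le q₂ _ b h₂.nonneg h₁.feasible
  rw [dotProduct_sub, dotProduct_sub]
  linarith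

/-- **Monotone LCP, I.** If `Q` is positive semi-definite (monotone; symmetry not assumed), the
difference form of two solutions vanishes. -/
theorem lcp_diff_form_eq_zero_of_psd (Q : Matrix ι ι ℝ) (b q₁ q₂ : ι → ℝ)
    (hpsd : ∀ v : ι → ℝ, 0 ≤ v ⬝ᵥ (Q *ᵥ v))
    (h₁ : IsLCPSolution Q b q₁) (h₂ : IsLCPSolution Q b q₂) :
    (q₁ - q₂) ⬝ᵥ (Q *ᵥ (q₁ - q₂)) = 0 :=
  le_antisymm (lcp_diff_form_nonpos Q b q₁ q₂ h₁ h₂) (hpsd _)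

/-- **Monotone LCP, II (cross-complementarity).** For monotone `Q`, each solution is complementary
to the slack of the other: `q₁ ⬝ (Q q₂ - b) = 0` and `q₂ ⬝ (Q q₁ - b) = 0`. -/
theorem lcp_cross_compl_of_psd (Q : Matrix ι ι ℝ) (b q₁ q₂ : ι → ℝ)
    (hpsd : ∀ v : ι → ℝ, 0 ≤ v ⬝ᵥ (Q *ᵥ v))
    (h₁ : IsLCPSolution Q b q₁) (h₂ : IsLCPSolution Q b q₂) :
    q₁ ⬝ᵥ (Q *ᵥ q₂ - b) = 0 ∧ q₂ ⬝ᵥ (Q *ᵥ q₁ - b) = 0 := by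
  have h0 := lcp_diff_form_eq_zero_of_psd Q b q₁ q₂ hpsd h₁ h₂
  rw [lcp_diff_form_eq Q b q₁ q₂ h₁ h₂] at h0
  have hc₁ : 0 ≤ q₁ ⬝ᵥ (Q *ᵥ q₂ - b) := by
    rw [dotProduct_sub]
    have := dotProduct_le_of_nonneg_of_le q₁ _ b h₁.nonneg h₂.feasible
    linarith
  have hc₂ : 0 ≤ q₂ ⬝ᵥ (Q *ᵥ q₁ - b) := by
    rw [dotProduct_sub]
    have := dotProduct_le_of_nonneg_of_le q₂ _ b h₂.nonneg h₁.feasible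
    linarith
  constructor <;> linarith

/-- **Monotone LCP, III (uniqueness modulo the kernel of the form).** If `Q` is monotone and its
quadratic form vanishes only on constant vectors (the Thomas–Fermi class: symbol `w³k⁶/(1+w⁶k⁶)`
vanishes only at `k = 0`), two solutions differ by a constant. -/
theorem lcp_sub_const_of_psd (Q : Matrix ι ι ℝ) (b q₁ q₂ : ι → ℝ)
    (hpsd : ∀ v : ι → ℝ, 0 ≤ v ⬝ᵥ (Q *ᵥ v))
    (hker : ∀ v : ι → ℝ, v ⬝ᵥ (Q *ᵥ v) = 0 → ∃ c : ℝ, ∀ i, v i = c)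
    (h₁ : IsLCPSolution Q b q₁) (h₂ : IsLCPSolution Q b q₂) :
    ∃ c : ℝ, ∀ i, q₁ i = q₂ i + c := by
  obtain ⟨c, hc⟩ := hker _ (lcp_diff_form_eq_zero_of_psd Q b q₁ q₂ hpsd h₁ h₂)
  refine ⟨c, fun i => ?_⟩
  have := hc i
  simp only [Pi.sub_apply] at this
  linarith

/-- A solution that is strictly positive everywhere has zero slack: `Q q = b`. -/
theorem lcp_slack_eq_zero_of_pos (Q : Matrix ι ι ℝ) (b q : ι → ℝ) (h : IsLCPSolution Q b q)
    (hpos : ∀ i, 0 < q i) : ∀ i, (Q *ᵥ q) i = b i := by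
  have hsum : ∑ i, q i * ((Q *ᵥ q) i - b i) = 0 := by
    have := h.compl
    unfold dotProduct at this
    simpa [Pi.sub_apply] using this
  have hnn : ∀ i ∈ Finset.univ, 0 ≤ q i * ((Q *ᵥ q) i - b i) :=
    fun i _ => mul_nonneg (hpos i).le (sub_nonneg.mpr (h.feasible i))
  intro i
  have hi := (Finset.sum_eq_zero_iff_of_nonneg hnn).mp hsum i (Finset.mem_univ i)
  rcases mul_eq_zero.mp hi with h0 | h0
  · exact absurd h0 (hpos i).ne'
  · linarith

/-- Conservativity: if the columns of `Q` sum to zero (`1ᵀ Q = 0`, as for `∂³S_w` on a periodic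
window), then `∑ᵢ (Q q)ᵢ = 0` for every `q`. -/
theorem sum_mulVec_eq_zero_of_cols (Q : Matrix ι ι ℝ) (hcol : (fun _ => (1 : ℝ)) ᵥ* Q = 0)
    (q : ι → ℝ) : ∑ i, (Q *ᵥ q) i = 0 := by
  have : (fun _ => (1 : ℝ)) ⬝ᵥ (Q *ᵥ q) = 0 := by
    rw [Matrix.dotProduct_mulVec, hcol, zero_dotProduct]
  unfold dotProduct at this
  simpa using this

/-- **Monotone conservative LCP: uniqueness.** If `Q` is monotone, its form vanishes only on
constants, its columns sum to zero, and the total supercriticality `∑ b` is nonzero (for `b = 1 - s²`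
on a wide window it is negative), then `LCP(Q, b)` has at most one solution.  This is the discrete
form of the selection statement of §24.17(7)(e): the finite-`n` Thomas–Fermi LCP determines the
pattern envelope uniquely, although `Q` is not positive definite. -/
theorem lcp_unique_of_psd_conservative (Q : Matrix ι ι ℝ) (b q₁ q₂ : ι → ℝ)
    (hpsd : ∀ v : ι → ℝ, 0 ≤ v ⬝ᵥ (Q *ᵥ v))
    (hker : ∀ v : ι → ℝ, v ⬝ᵥ (Q *ᵥ v) = 0 → ∃ c : ℝ, ∀ i, v i = c)
    (hcol : (fun _ => (1 : ℝ)) ᵥ* Q = 0) (hb : ∑ i, b i ≠ 0)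
    (h₁ : IsLCPSolution Q b q₁) (h₂ : IsLCPSolution Q b q₂) : q₁ = q₂ := by
  -- Two solutions differ by a constant `c`; if `c ≠ 0` the larger one is strictly positive, hence has
  -- zero slack, `Q q = b`, and summing gives `∑ b = 0`.
  have key : ∀ (p r : ι → ℝ), IsLCPSolution Q b p → IsLCPSolution Q b r →
      ∀ c : ℝ, 0 < c → (∀ i, p i = r i + c) → False := by
    intro p r hp hr c hc hpr
    have hpos : ∀ i, 0 < p i := fun i => by rw [hpr i]; linarith [hr.nonneg i]
    have hsl := lcp_slack_eq_zero_of_pos Q b p hp hpos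
    have hs := sum_mulVec_eq_zero_of_cols Q hcol p
    rw [Finset.sum_congr rfl (fun i _ => hsl i)] at hs
    exact hb hs
  obtain ⟨c, hc⟩ := lcp_sub_const_of_psd Q b q₁ q₂ hpsd hker h₁ h₂
  rcases lt_trichotomy c 0 with hneg | hzero | hposc
  · -- then q₂ = q₁ + (-c) with -c > 0
    exact (key q₂ q₁ h₂ h₁ (-c) (by linarith) (fun i => by rw [hc i]; ring)).elim
  · funext i; rw [hc i, hzero, add_zero]
  · exact (key q₁ q₂ h₁ h₂ c hposc hc).elim

end Summit.AnomalousDissipation.AnomalousDissipation.Theorems
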